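import Mathlib
import Summits.Ventures.PercRepro2.Defs
import Summits.Ventures.PercRepro2.CoinDefs
import Summits.Ventures.PercRepro2.CoinArcsOff

/-!
# Pendant out-structures at the head of the arc: tools (blind cell PercRepro2, night-2;
proofs/NIGHT2-DARC.md §11)

Let `Z′ ∋ w` be a vertex set (the forward closure of `w` minus `T`) with `ClosedOut` (every arc with
tail in `Z′` has its head in `Z′ ∪ T`), `EntryOnly` (every arc with head in `Z′ ∖ {w}` has its tail in
`Z′`) and `TailCoinsIn` (the pendant coins — those with an arc with tail in `Z′` — carry only tails in
`Z′ ∪ T`; mixed systems).  With `Z = Z′ ∪ T` and `D₀ = arcsOff arcs Z`: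
* `reach_split'` — path splitting with continuation; `reach_into_pendant` — a reduced path from
  outside `Z′` enters `Z′` only at `w`;
* `bwdEvent_iff_arcsOn`, `reach_arcsOn_congr` — `{w ∈ K⁻}` is decided by the pendant coins alone;
* `avoidEvent_pendant`, `reach_iff_pendant`, `avoid_inter_compl_bwd`, `reach_iff_compl_bwd` — on the
  two branches `{w ∉ K⁻}` / `{w ∈ K⁻}` the avoidance events and the markers are those of `D₀`;
* `gateEvent_bwd_decomp`, `avoidEvent_bwd_decomp` — the (general) decomposition of the gate and of
  `R_T` by `{w ∈ K⁻}`.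
Used by `CoinPendant.lean` (the conditional theorem `darc_of_pendant`).
-/

namespace Summit.Ventures.PercRepro2.Coin

section Pendant

variable {V : Type*} {E : Type*} [DecidableEq V]

/-- Coins carrying an arc whose tail lies in `Z′`. -/
def tailCoins (arcs : E → Finset (V × V)) (Z' : Finset V) : Set E := {e | ∃ xy ∈ arcs e, xy.1 ∈ Z'}

/-- Every arc with tail in `Z′` has its head in `Z′ ∪ T`. -/
def ClosedOut (arcs : E → Finset (V × V)) (Z' T : Finset V) : Prop :=
  ∀ e, ∀ xy ∈ arcs e, xy.1 ∈ Z' → xy.2 ∈ Z' ∪ T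

/-- Every arc with head in `Z′ ∖ {w}` has its tail in `Z′`. -/
def EntryOnly (arcs : E → Finset (V × V)) (Z' : Finset V) (w : V) : Prop :=
  ∀ e, ∀ xy ∈ arcs e, xy.2 ∈ Z' → xy.2 ≠ w → xy.1 ∈ Z'

/-- The pendant coins carry only arcs with tails in `Z′ ∪ T`. -/
def TailCoinsIn (arcs : E → Finset (V × V)) (Z' T : Finset V) : Prop :=
  ∀ e ∈ tailCoins arcs Z', ∀ xy ∈ arcs e, xy.1 ∈ Z' ∪ T

/-- The arc map restricted to arcs with tails in `Z′`. -/
def arcsOn (arcs : E → Finset (V × V)) (Z' : Finset V) : E → Finset (V × V) :=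
  fun e => (arcs e).filter (fun xy => xy.1 ∈ Z')

/-- **Path splitting with continuation**: a path either lives in the reduced map or reaches a vertex
of `Z` inside the reduced map and continues from it in the original map. -/
lemma reach_split' {arcs : E → Finset (V × V)} (Z : Finset V) {ω : Config E} {x y : V}
    (h : Reach arcs ω x y) :
    Reach (arcsOff arcs Z) ω x y ∨ ∃ z ∈ Z, Reach (arcsOff arcs Z) ω x z ∧ Reach arcs ω z y := by
  induction h with
  | refl => exact Or.inl (reach_refl _ ω x)
  | @tail y' y _ hstep ih =>
    rcases ih with h₀ | ⟨z, hz, hxz, hzy'⟩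
    · by_cases hy' : y' ∈ Z
      · exact Or.inr ⟨y', hy', h₀, reach_of_openArc hstep⟩
      · obtain ⟨e, he, hxy⟩ := hstep
        have hxy' : (y', y) ∈ arcsOff arcs Z e := by
          simp only [arcsOff, Finset.mem_filter]; exact ⟨hxy, hy'⟩
        exact Or.inl (Relation.ReflTransGen.tail h₀ ⟨e, he, hxy'⟩)
    · exact Or.inr ⟨z, hz, hxz, reach_trans hzy' (reach_of_openArc hstep)⟩

/-- A reduced path from outside `Z′` can enter `Z′` only at `w`. -/
lemma reach_into_pendant {arcs : E → Finset (V × V)} {Z' T : Finset V} {w : V}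
    (hentry : EntryOnly arcs Z' w) {s : V} (hs : s ∉ Z') {ω : Config E} {z : V}
    (h : Reach (arcsOff arcs (Z' ∪ T)) ω s z) (hz : z ∈ Z') : z = w := by
  induction h with
  | refl => exact absurd hz hs
  | @tail y' y _ hstep _ =>
    obtain ⟨e, he, hxy⟩ := hstep
    simp only [arcsOff, Finset.mem_filter, Finset.mem_union, not_or] at hxy
    by_contra hne
    exact hxy.2.1 (hentry e (y', y) hxy.1 hz hne)

/-- A path along arcs with tails in `Z′` stays in `Z′ ∪ T`. -/
lemma reach_arcsOn_stay {arcs : E → Finset (V × V)} {Z' T : Finset V} (hclosed : ClosedOut arcs Z' T)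
    {w : V} (hw : w ∈ Z') {ω : Config E} {y : V} (h : Reach (arcsOn arcs Z') ω w y) :
    y ∈ Z' ∪ T := by
  induction h with
  | refl => exact Finset.mem_union_left T hw
  | @tail y' y _ hstep _ =>
    obtain ⟨e, he, hxy⟩ := hstep
    simp only [arcsOn, Finset.mem_filter] at hxy
    exact hclosed e (y', y) hxy.1 hxy.2

/-- From `w`, a path of the original map either stays on arcs with tails in `Z′` or hits `T` along
such arcs first. -/
lemma reach_from_pendant {arcs : E → Finset (V × V)} {Z' T : Finset V}
    (hclosed : ClosedOut arcs Z' T) {w : V} (hw : w ∈ Z') {ω : Config E} {y : V}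
    (h : Reach arcs ω w y) :
    Reach (arcsOn arcs Z') ω w y ∨ ∃ t ∈ T, Reach (arcsOn arcs Z') ω w t := by
  induction h with
  | refl => exact Or.inl (reach_refl _ ω w)
  | @tail y' y _ hstep ih =>
    rcases ih with h₀ | h₀
    · by_cases hy' : y' ∈ Z'
      · obtain ⟨e, he, hxy⟩ := hstep
        have hxy' : (y', y) ∈ arcsOn arcs Z' e := by
          simp only [arcsOn, Finset.mem_filter]; exact ⟨hxy, hy'⟩
        exact Or.inl (Relation.ReflTransGen.tail h₀ ⟨e, he, hxy'⟩)
      · have hmem := reach_arcsOn_stay hclosed hw h₀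
        rw [Finset.mem_union] at hmem
        rcases hmem with h₁ | h₁
        · exact absurd h₁ hy'
        · exact Or.inr ⟨y', h₁, h₀⟩
    · exact Or.inr h₀

/-- Reachability along `arcsOn` implies reachability. -/
lemma reach_of_reach_arcsOn {arcs : E → Finset (V × V)} {Z' : Finset V} {ω : Config E} {x y : V}
    (h : Reach (arcsOn arcs Z') ω x y) : Reach arcs ω x y := by
  induction h with
  | refl => exact reach_refl arcs ω x
  | tail _ hstep ih =>
    obtain ⟨e, he, hxy⟩ := hstep
    simp only [arcsOn, Finset.mem_filter] at hxy
    exact reach_trans ih (reach_of_openArc ⟨e, he, hxy.1⟩)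

/-- `w ∈ K⁻` iff `w` reaches `T` along arcs with tails in `Z′`. -/
lemma bwdEvent_iff_arcsOn {arcs : E → Finset (V × V)} {Z' T : Finset V}
    (hclosed : ClosedOut arcs Z' T) {w : V} (hw : w ∈ Z') (ω : Config E) :
    ω ∈ bwdEvent arcs w T ↔ ∃ t ∈ T, Reach (arcsOn arcs Z') ω w t := by
  constructor
  · rintro ⟨t, ht, hr⟩
    rcases reach_from_pendant hclosed hw hr with h₀ | h₀
    · exact ⟨t, ht, h₀⟩
    · exact h₀
  · rintro ⟨t, ht, hr⟩
    exact ⟨t, ht, reach_of_reach_arcsOn hr⟩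

/-- Reachability along `arcsOn` depends only on the pendant coins. -/
lemma reach_arcsOn_congr {arcs : E → Finset (V × V)} {Z' : Finset V} {ω ω' : Config E}
    (h : ∀ e ∈ tailCoins arcs Z', ω e = ω' e) {x y : V} :
    Reach (arcsOn arcs Z') ω x y ↔ Reach (arcsOn arcs Z') ω' x y := by
  have key : ∀ {p q : V}, OpenArc (arcsOn arcs Z') ω p q ↔ OpenArc (arcsOn arcs Z') ω' p q := by
    intro p q
    constructor
    · rintro ⟨e, he, hpq⟩
      refine ⟨e, ?_, hpq⟩
      simp only [arcsOn, Finset.mem_filter] at hpq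
      rw [← h e ⟨(p, q), hpq.1, hpq.2⟩]; exact he
    · rintro ⟨e, he, hpq⟩
      refine ⟨e, ?_, hpq⟩
      simp only [arcsOn, Finset.mem_filter] at hpq
      rw [h e ⟨(p, q), hpq.1, hpq.2⟩]; exact he
  constructor
  · intro hr
    induction hr with
    | refl => exact Relation.ReflTransGen.refl
    | tail _ hstep ih => exact Relation.ReflTransGen.tail ih (key.mp hstep)
  · intro hr
    induction hr with
    | refl => exact Relation.ReflTransGen.refl
    | tail _ hstep ih => exact Relation.ReflTransGen.tail ih (key.mpr hstep)

/-- The reduced map is empty on the pendant coins. -/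
lemma arcsOff_eq_empty_of_tailCoins {arcs : E → Finset (V × V)} {Z' T : Finset V}
    (hT : TailCoinsIn arcs Z' T) {e : E} (he : e ∈ tailCoins arcs Z') :
    arcsOff arcs (Z' ∪ T) e = ∅ := by
  ext xy
  simp only [arcsOff, Finset.mem_filter, Finset.notMem_empty, iff_false, not_and, not_not]
  intro hxy
  exact hT e he xy hxy

/-- Avoidance events containing `insert w T` coincide for the original and the reduced map (the
reduced set `Z = Z′ ∪ T` may be larger than the avoided set: entry only at `w`). -/
lemma avoidEvent_pendant {arcs : E → Finset (V × V)} {Z' T X : Finset V} {w : V}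
    (hentry : EntryOnly arcs Z' w) {s : V} (hs : s ∉ Z') (hwX : w ∈ X) (hTX : T ⊆ X) :
    avoidEvent arcs s X = avoidEvent (arcsOff arcs (Z' ∪ T)) s X := by
  ext ω
  constructor
  · intro hω t ht hr
    exact hω t ht (reach_of_reach_arcsOff hr)
  · intro hω t ht hr
    rcases reach_split' (Z' ∪ T) hr with h₀ | ⟨z, hz, hsz, _⟩
    · exact hω t ht h₀
    · rw [Finset.mem_union] at hz
      rcases hz with hz | hz
      · have := reach_into_pendant hentry hs hsz hz
        subst this
        exact hω _ hwX hsz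
      · exact hω z (hTX hz) hsz

/-- On an avoidance event containing `insert w T`, reachability from `s` is that of the reduced map. -/
lemma reach_iff_pendant {arcs : E → Finset (V × V)} {Z' T X : Finset V} {w : V}
    (hentry : EntryOnly arcs Z' w) {s : V} (hs : s ∉ Z') (hwX : w ∈ X) (hTX : T ⊆ X)
    {ω : Config E} (hω : ω ∈ avoidEvent arcs s X) (a : V) :
    Reach arcs ω s a ↔ Reach (arcsOff arcs (Z' ∪ T)) ω s a := by
  constructor
  · intro h
    rcases reach_split' (Z' ∪ T) h with h₀ | ⟨z, hz, hsz, _⟩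
    · exact h₀
    · rw [Finset.mem_union] at hz
      rcases hz with hz | hz
      · have := reach_into_pendant hentry hs hsz hz
        subst this
        exact absurd (reach_of_reach_arcsOff hsz) (hω _ hwX)
      · exact absurd (reach_of_reach_arcsOff hsz) (hω z (hTX hz))
  · exact reach_of_reach_arcsOff

/-- On `Gᶜ` (`w ∉ K⁻`), `R_T` is the reduced avoidance event. -/
lemma avoid_inter_compl_bwd {arcs : E → Finset (V × V)} {Z' T : Finset V} {w : V}
    (hentry : EntryOnly arcs Z' w) {s : V} (hs : s ∉ Z') :
    avoidEvent arcs s T ∩ (bwdEvent arcs w T)ᶜ =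
      avoidEvent (arcsOff arcs (Z' ∪ T)) s T ∩ (bwdEvent arcs w T)ᶜ := by
  ext ω
  simp only [Set.mem_inter_iff, Set.mem_compl_iff]
  constructor
  · rintro ⟨hR, hG⟩
    exact ⟨fun t ht hr => hR t ht (reach_of_reach_arcsOff hr), hG⟩
  · rintro ⟨hR, hG⟩
    refine ⟨fun t ht hr => ?_, hG⟩
    rcases reach_split' (Z' ∪ T) hr with h₀ | ⟨z, hz, hsz, hzt⟩
    · exact hR t ht h₀
    · rw [Finset.mem_union] at hz
      rcases hz with hz | hz
      · have := reach_into_pendant hentry hs hsz hz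
        subst this
        exact hG ⟨t, ht, hzt⟩
      · exact hR z hz hsz

/-- On `R_T ∩ Gᶜ`, reachability of a vertex outside `Z′ ∪ T` is that of the reduced map. -/
lemma reach_iff_compl_bwd {arcs : E → Finset (V × V)} {Z' T : Finset V} {w : V}
    (hclosed : ClosedOut arcs Z' T) (hentry : EntryOnly arcs Z' w) (hw : w ∈ Z') {s : V}
    (hs : s ∉ Z') {ω : Config E} (hR : ω ∈ avoidEvent arcs s T) (hG : ω ∉ bwdEvent arcs w T)
    {a : V} (ha : a ∉ Z' ∪ T) :
    Reach arcs ω s a ↔ Reach (arcsOff arcs (Z' ∪ T)) ω s a := by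
  constructor
  · intro h
    rcases reach_split' (Z' ∪ T) h with h₀ | ⟨z, hz, hsz, hza⟩
    · exact h₀
    · rw [Finset.mem_union] at hz
      rcases hz with hz | hz
      · have := reach_into_pendant hentry hs hsz hz
        subst this
        rcases reach_from_pendant hclosed hw hza with h₁ | ⟨t, ht, h₁⟩
        · exact absurd (reach_arcsOn_stay hclosed hw h₁) ha
        · exact absurd ⟨t, ht, reach_of_reach_arcsOn h₁⟩ hG
      · exact absurd (reach_of_reach_arcsOff hsz) (hR z hz)
  · exact reach_of_reach_arcsOff

/-- **The pendant decomposition of the gate event** (general: no pendant hypothesis needed). -/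
theorem gateEvent_bwd_decomp (arcs : E → Finset (V × V)) (s : V) (T : Finset V) (u w : V) :
    gateEvent arcs s T u w =
      ((bwdEvent arcs w T)ᶜ ∩ avoidEvent arcs s T) ∪
        (bwdEvent arcs w T ∩ avoidEvent arcs s (insert u (insert w T))) := by
  rw [gateEvent_eq_union]
  ext ω
  by_cases hG : ω ∈ bwdEvent arcs w T
  · simp only [Set.mem_inter_iff, Set.mem_union, Set.mem_compl_iff, hG, not_true_eq_false,
      false_and, false_or, or_false, true_and]
    constructor
    · rintro ⟨hR, hu⟩ t ht
      simp only [Finset.mem_insert] at ht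
      rcases ht with rfl | rfl | ht
      · exact hu
      · intro hsw
        obtain ⟨t', ht', hwt⟩ := hG
        exact hR t' ht' (reach_trans hsw hwt)
      · exact hR t ht
    · intro h
      exact ⟨fun t ht => h t (by simp [ht]), h u (by simp)⟩
  · simp only [Set.mem_inter_iff, Set.mem_union, Set.mem_compl_iff, hG, not_false_eq_true,
      or_true, and_true, false_and, or_false, true_and]

/-- **The pendant decomposition of `R_T`** (general). -/
theorem avoidEvent_bwd_decomp (arcs : E → Finset (V × V)) (s : V) (T : Finset V) (w : V) :
    avoidEvent arcs s T =
      ((bwdEvent arcs w T)ᶜ ∩ avoidEvent arcs s T) ∪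
        (bwdEvent arcs w T ∩ avoidEvent arcs s (insert w T)) := by
  ext ω
  by_cases hG : ω ∈ bwdEvent arcs w T
  · simp only [Set.mem_inter_iff, Set.mem_union, Set.mem_compl_iff, hG, not_true_eq_false,
      false_and, false_or, true_and]
    constructor
    · intro hR t ht
      simp only [Finset.mem_insert] at ht
      rcases ht with rfl | ht
      · intro hsw
        obtain ⟨t', ht', hwt⟩ := hG
        exact hR t' ht' (reach_trans hsw hwt)
      · exact hR t ht
    · intro h t ht
      exact h t (by simp [ht])
  · simp only [Set.mem_inter_iff, Set.mem_union, Set.mem_compl_iff, hG, not_false_eq_true,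
      true_and, false_and, or_false]

end Pendant

end Summit.Ventures.PercRepro2.Coin
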